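import Summits.QuantumFields.BalabanUV.Beta.EriceFlowEnclosureBorelSumCalc
import Summits.QuantumFields.BalabanUV.Beta.EriceFlowEnclosureBorelTransformStrip

/-!
# Beta / EriceFlowEnclosureBorelNevanlinna — NEVANLINNA'S THEOREM IN THE DISC ∕ STRIP FORM (F. Nevanlinna 1919, A. Sokal 1980; the
# form «used in practice» in constructive field theory): a function holomorphic on the BOREL DISC `C_r = {Re(1∕z) > 1∕r}` with the
# UNIFORM Gevrey-1 expansion `‖f z − Σ_{n<N} a_n zⁿ‖ ≤ C·K^N·N!·‖z‖^N` there has a Borel transform `B` HOLOMORPHIC ON THE DISC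
# `‖τ‖ < 1∕K` UNION THE HALF-STRIP `{Re τ > 0, |Im τ| < 1∕K}` (= `{dist(τ, ℝ₊) < 1∕K}`), summing `Σ a_n τⁿ∕n!` on the disc, of
# exponential type `‖B τ‖ ≤ A(θ)·e^{c·Re τ}` on `|Im τ| ≤ θ∕K` for every `c > 1∕r`, with `f(z) = z⁻¹∫₀^∞ e^{−t∕z}B(t)dt` on `C_r` —
# the END of bflow-p3's exploratory MODULE 36 (34g assumed a sector of opening > π and produced a SECTOR; here the hypothesis has
# opening exactly π and the conclusion is Nevanlinna's STRIP)
# (bflow-p3 gen 39, MODULE 36f over 34c ∕ 34e ∕ 34f ∕ 36b ∕ 36e; Mathlib + tree only)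

HONEST FRAMING (page 1 of everything the β sub-cell writes): discharging `BetaPertH` makes Bałaban's UV stability UNCONDITIONAL — a
real constructive-QFT result; it is NOT the continuum limit and NOT the Clay problem.  HONEST DEPENDENCY (cell reorg 2026-08-19,
verbatim): «continuum YM on T⁴ ⇐ BetaPertH ∧ nine spine estimates (0/9 proved); BetaPertH ⇐ (D1) ∧ (D4) ∧ CAP+tail; G-an2-4 gates
asym, D1 and NE2/3/4.»  THIS MODULE DISCHARGES NOTHING: [folklore] one-variable complex analysis over Mathlib and the tree (no
β-function, no flow, no Erice sentence is used); it serves no interface object of the β-flow lineage (those are sectorial — 34g∕35)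
and is filed as the reusable classical statement.

SOURCE (shapes only).  [Rivasseau1991] Thm I.5.1 pp. 55–56 (our condensation of the print: f analytic in the disk C_R = {y | Re y⁻¹ > 1∕R}
with |R_r(y)| ≤ Cσ^r r!|y|^r uniformly in C_R ⟹ B(t) = Σ a_k t^k∕k! converges for |t| < 1∕σ, admits an analytic continuation in the
strip S_σ = {t | dist(t, ℝ⁺) < 1∕σ} with |B(t)| ≤ const·e^{|t|∕R} there, and f(y) = (1∕y)∫₀^∞ e^{−t∕y}B(t)dt on C_R; «it is the direct
theorem which is used in practice» is verbatim); [LodayRichaud2016] Thm 5.3.9 pp. 156–163 (Nevanlinna's theorem, (ii)⇒(i)).  Ours: the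
exponential bound on the closed sub-strips `|Im τ| ≤ θ∕K` with any rate `c > 1∕r` (the printed `const·e^{t∕R}` on `ℝ₊` is `θ = 0`
up to `c ↓ 1∕r`).

THE POINT.  `G(w) = (f(w⁻¹) − a₀)∕w` on `Re w > 1∕r` (36b's set-agnostic remainders); the Borel transform on the line `b` (34c) has
its letters on `]0, 1∕(eK)[` (34e) and the Bromwich integral `J = 2πb` is `C^∞` on `(0,∞)` with `‖J^{(k)}(t)‖ ≤ 2πC·K^k k!·(k+1)(k+2)·L(t)`
(36c); its Taylor discs of radius `1∕K` (36d) glue to `𝒥` holomorphic on the half-strip (36e); the Borel series (34f) and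
`a₀ + 𝒥∕(2π)` agree on `ball ∩ strip` (identity theorem from `]0, 1∕(2eK)]`); `B := Borel series` on the disc, `a₀ + 𝒥∕(2π)` beyond;
the Laplace representation is 34c `laplace_repr` + `B = a₀ + b` on `ℝ₊`, as in 34g.

WHAT THIS FILE PROVES (0 sorry, 0 def).  HEADLINE **`nevanlinna_disc`**: `0 < r`, `0 < K`, `1∕r < c`, `f` holomorphic on
`{Re z⁻¹ > 1∕r}` with `‖f z − Σ_{n<N} a_n zⁿ‖ ≤ C·K^N·N!·‖z‖^N` there ⟹ ∃ B : ℂ → ℂ, `DifferentiableOn ℂ B (ball 0 K⁻¹ ∪ {0 < Re τ ∧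
|Im τ| < K⁻¹})` ∧ `∀ τ, ‖τ‖ < K⁻¹ → HasSum (n ↦ a_n τⁿ∕n!) (B τ)` ∧ `∀ θ ∈ [0,1[, ∀ τ, 0 < Re τ → |Im τ| ≤ θ∕K →
‖B τ‖ ≤ (‖a₀‖ + C(1 + K∕c + K²∕(2c²))·Σ_k(6k²+2)θ^k)·e^{c·Re τ}` ∧ `∀ z, 1∕r < Re z⁻¹ → IntegrableOn (t ↦ e^{−t z⁻¹}B t) (Ioi 0) ∧
f z = z⁻¹·∫_{t>0} e^{−t z⁻¹}B(t)dt`.  Axioms: the standard trio.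
NOT CLAIMED: the converse (i)⇒(ii) with uniform bounds on the whole disc ([LodayRichaud2016] pp. 158–160's path `γ_b`; 34i gives proper
sub-sectors), levels `k ≠ 1`, anything about Erice's β; `BetaPertH`, continuum, Clay.
-/

namespace Summit.QuantumFields.BalabanUV.Beta.EriceFlowEnclosureBorelNevanlinna

open Set Filter Topology MeasureTheory Metric Complex
open scoped Real FourierTransform Nat
open Summit.QuantumFields.BalabanUV.Beta.EriceFlowEnclosureBorelTransform
open Summit.QuantumFields.BalabanUV.Beta.EriceFlowEnclosureBorelSeries (hasSum_bline)
open Summit.QuantumFields.BalabanUV.Beta.EriceFlowEnclosureBorelSumCalc (borelSeries_differentiableOn laplace_const)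
open Summit.QuantumFields.BalabanUV.Beta.EriceFlowEnclosureBorelTransformPieces
open Summit.QuantumFields.BalabanUV.Beta.EriceFlowEnclosureBorelTransformStrip

noncomputable section

/-- **NEVANLINNA'S THEOREM (disc ⟹ strip).**  Let `f` be holomorphic on the Borel disc `{Re z⁻¹ > 1∕r}` with the UNIFORM Gevrey-1
expansion `‖f z − Σ_{n<N} a_n zⁿ‖ ≤ C·K^N·N!·‖z‖^N` there (all `N`, `z`), `0 < K`, and fix a rate `c > 1∕r`.  Then there is a Borel
transform `B`, HOLOMORPHIC on the disc `‖τ‖ < 1∕K` union the half-strip `{Re τ > 0, |Im τ| < 1∕K}`, summing the Borel series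
`Σ a_n τⁿ∕n!` on the disc, of exponential type `c` in `Re τ` on every closed sub-strip `|Im τ| ≤ θ∕K` (`0 ≤ θ < 1`), and RECOVERING `f`:
`f z = z⁻¹·∫₀^∞ e^{−t∕z}B(t)dt` (absolutely convergent) for `Re z⁻¹ > 1∕r`.
[cite: Rivasseau1991, Thm I.5.1 pp.55–56] [cite: LodayRichaud2016, Thm 5.3.9 (ii)⇒(i)] -/
theorem nevanlinna_disc {f : ℂ → ℂ} {a : ℕ → ℂ} {r C K c : ℝ} (hr : 0 < r) (hK : 0 < K) (hc : 1 / r < c)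
    (hf : DifferentiableOn ℂ f {z : ℂ | 1 / r < (z⁻¹).re})
    (hgev : ∀ N : ℕ, ∀ z ∈ {z : ℂ | 1 / r < (z⁻¹).re},
      ‖f z - ∑ n ∈ Finset.range N, a n * z ^ n‖ ≤ C * K ^ N * N ! * ‖z‖ ^ N) :
    ∃ B : ℂ → ℂ,
      DifferentiableOn ℂ B (ball 0 K⁻¹ ∪ {τ : ℂ | 0 < τ.re ∧ |τ.im| < K⁻¹}) ∧
      (∀ τ : ℂ, ‖τ‖ < K⁻¹ → HasSum (fun n : ℕ => a n * (τ ^ n / (n ! : ℂ))) (B τ)) ∧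
      (∀ θ : ℝ, 0 ≤ θ → θ < 1 → ∀ τ : ℂ, 0 < τ.re → |τ.im| ≤ θ / K →
        ‖B τ‖ ≤ (‖a 0‖ + C * (1 + K / c + K ^ 2 / (2 * c ^ 2)) * ∑' k : ℕ, (6 * (k : ℝ) ^ 2 + 2) * θ ^ k) *
          Real.exp (c * τ.re)) ∧
      (∀ z : ℂ, 1 / r < (z⁻¹).re →
        IntegrableOn (fun t : ℝ => cexp (-(t : ℂ) * z⁻¹) * B t) (Ioi 0) ∧
        f z = z⁻¹ * ∫ t in Ioi (0 : ℝ), cexp (-(t : ℂ) * z⁻¹) * B t) := by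
  -- ### constants and regions
  set ρ : ℝ := 1 / r with hρdef
  have hρ : 0 < ρ := by positivity
  set D : Set ℂ := {z : ℂ | ρ < (z⁻¹).re} with hD
  have hcpos : 0 < c := hρ.trans hc
  have hC : 0 ≤ C := by
    have hmem : (((r / 2 : ℝ)) : ℂ) ∈ D := ofReal_mem_borelDisc hρ (by positivity) (by rw [hρdef, one_div_one_div]; linarith)
    have h := hgev 0 _ hmem
    simp at h
    exact (norm_nonneg _).trans h
  have hM₀ : 0 ≤ C * K := mul_nonneg hC hK.le
  -- ### the inverted function on the half-plane `Re w > ρ`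
  set G : ℂ → ℂ := fun w => (f w⁻¹ - a 0) / w with hG
  have hH0 : ∀ w : ℂ, ρ < w.re → w ≠ 0 ∧ w⁻¹ ∈ D := fun w hw => inv_mem_borelDisc hρ.le hw
  have hGdH : DifferentiableOn ℂ G {w : ℂ | ρ < w.re} := by
    have h1 : DifferentiableOn ℂ (fun w : ℂ => f w⁻¹) {w : ℂ | ρ < w.re} :=
      hf.comp (differentiableOn_inv.mono fun w hw => (hH0 w hw).1) fun w hw => (hH0 w hw).2
    exact (h1.sub_const (a 0)).div differentiableOn_id fun w hw => (hH0 w hw).1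
  have hGremH : ∀ N : ℕ, 1 ≤ N → ∀ w : ℂ, ρ < w.re →
      ‖G w - ∑ n ∈ Finset.Ico 1 N, a n * (1 / w ^ (n + 1))‖ ≤ C * K ^ N * N ! / ‖w‖ ^ (N + 1) :=
    fun N hN w hw => remainder_G_of_mem hgev hN w (hH0 w hw).1 (hH0 w hw).2
  have hGbH : ∀ w : ℂ, ρ < w.re → ‖G w‖ ≤ C * K / ‖w‖ ^ 2 := by
    intro w hw; simpa using hGremH 1 le_rfl w hw
  have ha : ∀ n : ℕ, ‖a n‖ ≤ C * K ^ n * n ! :=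
    norm_letter_le_of_mem (r := r) hr (fun x hx hxr => ofReal_mem_borelDisc hρ hx (by rwa [hρdef, one_div_one_div])) hgev
  -- ### the Borel transform on the line (abscissa `c`)
  set b : ℝ → ℂ := fun t : ℝ =>
    (1 / (2 * π) : ℂ) * (Real.exp (c * t) : ℂ) * 𝓕 (fun x : ℝ => G ((c : ℂ) - (x : ℂ) * I)) (t / (2 * π)) with hb
  have hbbound : ∀ t : ℝ, ‖b t‖ ≤ C * K / (2 * c) * Real.exp (c * t) := fun t => norm_bline_le hρ hGbH hc t
  have hbindep : ∀ c' : ℝ, ρ < c' → ∀ t : ℝ,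
      (1 / (2 * π) : ℂ) * (Real.exp (c' * t) : ℂ) * 𝓕 (fun x : ℝ => G ((c' : ℂ) - (x : ℂ) * I)) (t / (2 * π)) = b t := by
    intro c' hc' t
    simp only [hb, mul_assoc]
    rw [bline_indep hρ hM₀ hGdH hGbH hc' hc t]
  have hbseries : ∀ t : ℝ, 0 < t → Real.exp 1 * K * t < 1 →
      HasSum (fun m : ℕ => a (m + 1) * ((t : ℂ) ^ (m + 1) / ((m + 1) ! : ℂ))) (b t) :=
    fun t ht hsmall => hasSum_bline hρ hGdH hC hK hGremH ha hc ht hsmall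
  -- ### the strip continuation `𝒥` of the Bromwich integral `J = 2π·b`
  set ST : Set ℂ := {τ : ℂ | 0 < τ.re ∧ |τ.im| < K⁻¹} with hST
  have hSTo : IsOpen ST := (isOpen_lt continuous_const Complex.continuous_re).inter
    (isOpen_lt (continuous_abs.comp Complex.continuous_im) continuous_const)
  set 𝒥 : ℂ → ℂ := fun τ : ℂ => ∑' k : ℕ,
    iteratedDeriv k (fun t : ℝ => ∫ s : ℝ, cexp ((t : ℂ) * ((c : ℂ) + (s : ℂ) * I)) * G ((c : ℂ) + (s : ℂ) * I)) τ.re *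
      ((τ - (τ.re : ℂ)) ^ k / (k ! : ℂ)) with h𝒥
  have h𝒥d : DifferentiableOn ℂ 𝒥 ST := differentiableOn_strip hρ hc hC hK hGdH hGremH ha
  have h𝒥real : ∀ t : ℝ, 0 < t → 𝒥 t = 2 * π * b t := by
    intro t ht
    have h1 := strip_ofReal hρ hc hC hK hGdH hGremH ha ht
    have hπ : (2 * π : ℂ) ≠ 0 := by exact_mod_cast (by positivity : (2 * π : ℝ) ≠ 0)
    have h2 : 𝒥 t = ∫ s : ℝ, cexp ((t : ℂ) * ((c : ℂ) + (s : ℂ) * I)) * G ((c : ℂ) + (s : ℂ) * I) := h1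
    rw [h2, line_eq_bline]
    simp only [hb]
    rw [← mul_assoc, ← mul_assoc, mul_one_div_cancel hπ, one_mul]
  set Jf : ℂ → ℂ := fun τ : ℂ => a 0 + (1 / (2 * π) : ℂ) * 𝒥 τ with hJf
  have hJfd : DifferentiableOn ℂ Jf ST := (h𝒥d.const_mul _).const_add _
  have hJf_real : ∀ t : ℝ, 0 < t → Jf t = a 0 + b t := by
    intro t ht
    simp only [hJf]
    rw [h𝒥real t ht]
    have hπ : (π : ℂ) ≠ 0 := by exact_mod_cast Real.pi_ne_zero
    field_simp
  -- ### the Borel series on the disc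
  obtain ⟨hsumm, hSerd⟩ := borelSeries_differentiableOn hK ha
  set Ser : ℂ → ℂ := fun τ : ℂ => ∑' n : ℕ, a n * (τ ^ n / (n ! : ℂ)) with hSer
  have hSer_real : ∀ t : ℝ, 0 < t → Real.exp 1 * K * t < 1 → Ser t = a 0 + b t := by
    intro t ht hsmall
    have h1 := hbseries t ht hsmall
    have h2 : HasSum (fun n : ℕ => a n * ((t : ℂ) ^ n / (n ! : ℂ))) (a 0 + b t) := by
      rw [← hasSum_nat_add_iff' 1]
      simpa using h1
    exact h2.tsum_eq
  -- ### Ser = Jf on `ball ∩ strip` (identity theorem)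
  set V : Set ℂ := ball 0 K⁻¹ ∩ ST with hV
  have hVo : IsOpen V := isOpen_ball.inter hSTo
  have hSTc : Convex ℝ ST := by
    have hl1 : IsLinearMap ℝ fun w : ℂ => w.re := ⟨fun x y => by simp, fun c x => by simp⟩
    have hl2 : IsLinearMap ℝ fun w : ℂ => w.im := ⟨fun x y => by simp, fun c x => by simp⟩
    have hST' : ST = {w : ℂ | 0 < w.re} ∩ ({w : ℂ | w.im < K⁻¹} ∩ {w : ℂ | -K⁻¹ < w.im}) := by
      ext w; simp only [hST, Set.mem_setOf_eq, Set.mem_inter_iff, abs_lt]; tauto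
    rw [hST']
    exact (convex_halfSpace_gt hl1 0).inter ((convex_halfSpace_lt hl2 _).inter (convex_halfSpace_gt hl2 _))
  have hVc : Convex ℝ V := (convex_ball _ _).inter hSTc
  set t₀ : ℝ := 1 / (4 * Real.exp 1 * K) with ht₀
  have he1 : 1 ≤ Real.exp 1 := Real.one_le_exp zero_le_one
  have ht₀pos : 0 < t₀ := by positivity
  have ht₀K : 4 * t₀ * (Real.exp 1 * K) = 1 := by rw [ht₀]; field_simp
  have hreal_mem : ∀ t : ℝ, 0 < t → t ≤ 2 * t₀ → ((t : ℂ)) ∈ V ∧ Ser t = Jf t := by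
    intro t ht ht2
    have heK : 0 < Real.exp 1 * K := by positivity
    have hsmall : Real.exp 1 * K * t < 1 := by
      have h1 : Real.exp 1 * K * t ≤ Real.exp 1 * K * (2 * t₀) := mul_le_mul_of_nonneg_left ht2 heK.le
      nlinarith
    have htK : t < K⁻¹ := by
      rw [inv_eq_one_div, lt_div_iff₀ hK]
      have h1 : t * K ≤ Real.exp 1 * K * t := by nlinarith [mul_pos ht hK]
      linarith
    refine ⟨⟨?_, ?_⟩, ?_⟩
    · rw [mem_ball_zero_iff, Complex.norm_real, Real.norm_of_nonneg ht.le]; exact htK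
    · simp only [hST, Set.mem_setOf_eq, Complex.ofReal_re, Complex.ofReal_im, abs_zero]
      exact ⟨ht, by positivity⟩
    · rw [hSer_real t ht hsmall, hJf_real t ht]
  have hEq : EqOn Ser Jf V := by
    have hz₀ : ((t₀ : ℂ)) ∈ V := (hreal_mem t₀ ht₀pos (by linarith)).1
    set y : ℕ → ℝ := fun n => t₀ + t₀ / ((n : ℝ) + 2) with hy
    have hy1 : ∀ n, t₀ < y n := fun n => by
      have : 0 < t₀ / ((n : ℝ) + 2) := by positivity
      simp only [hy]; linarith
    have hy2 : ∀ n, y n ≤ 2 * t₀ := fun n => by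
      have : t₀ / ((n : ℝ) + 2) ≤ t₀ := div_le_self ht₀pos.le (by linarith)
      simp only [hy]; linarith
    have hylim : Tendsto y atTop (𝓝 t₀) := by
      have h1 : Tendsto (fun n : ℕ => t₀ / ((n : ℝ) + 2)) atTop (𝓝 0) :=
        tendsto_const_nhds.div_atTop (tendsto_natCast_atTop_atTop.atTop_add tendsto_const_nhds)
      simpa using h1.const_add t₀
    have hyC : Tendsto (fun n => ((y n : ℝ) : ℂ)) atTop (𝓝[≠] ((t₀ : ℂ))) := by
      refine tendsto_nhdsWithin_iff.2 ⟨?_, Eventually.of_forall fun n => ?_⟩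
      · exact (Complex.continuous_ofReal.tendsto t₀).comp hylim
      · intro heq
        have := Complex.ofReal_inj.mp heq
        exact (hy1 n).ne' this
    have hfreq : ∃ᶠ z in 𝓝[≠] ((t₀ : ℂ)), Ser z = Jf z :=
      hyC.frequently (Frequently.of_forall fun n => (hreal_mem (y n) (ht₀pos.trans (hy1 n)) (hy2 n)).2)
    exact ((hSerd.mono inter_subset_left).analyticOnNhd hVo).eqOn_of_preconnected_of_frequently_eq
      ((hJfd.mono inter_subset_right).analyticOnNhd hVo) hVc.isPreconnected hz₀ hfreq
  -- ### the Borel function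
  set B : ℂ → ℂ := fun τ : ℂ => if ‖τ‖ < K⁻¹ then Ser τ else Jf τ with hB
  have hB_ball : ∀ τ : ℂ, ‖τ‖ < K⁻¹ → B τ = Ser τ := fun τ hτ => by simp only [hB, if_pos hτ]
  have hB_T : ∀ τ ∈ ST, B τ = Jf τ := by
    intro τ hτ
    by_cases h : ‖τ‖ < K⁻¹
    · rw [hB_ball τ h]; exact hEq ⟨mem_ball_zero_iff.mpr h, hτ⟩
    · simp only [hB, if_neg h]
  have hB_real : ∀ t : ℝ, 0 < t → B t = a 0 + b t := by
    intro t ht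
    have htT : ((t : ℂ)) ∈ ST := by
      simp only [hST, Set.mem_setOf_eq, Complex.ofReal_re, Complex.ofReal_im, abs_zero]
      exact ⟨ht, by positivity⟩
    rw [hB_T _ htT, hJf_real t ht]
  refine ⟨B, ?_, ?_, ?_, ?_⟩
  -- (1) holomorphy on the disc ∪ half-strip
  · intro τ hτ
    rcases hτ with hτ | hτ
    · have hev : B =ᶠ[𝓝 τ] Ser := by
        filter_upwards [isOpen_ball.mem_nhds hτ] with w hw using hB_ball w (mem_ball_zero_iff.mp hw)
      exact ((hSerd.differentiableAt (isOpen_ball.mem_nhds hτ)).congr_of_eventuallyEq hev).differentiableWithinAt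
    · have hev : B =ᶠ[𝓝 τ] Jf := by
        filter_upwards [hSTo.mem_nhds hτ] with w hw using hB_T w hw
      exact ((hJfd.differentiableAt (hSTo.mem_nhds hτ)).congr_of_eventuallyEq hev).differentiableWithinAt
  -- (2) the Borel series on the disc
  · intro τ hτ
    rw [hB_ball τ hτ]
    exact (hsumm τ hτ).hasSum
  -- (3) exponential type on the closed sub-strips
  · intro θ hθ0 hθ1 τ hτre hτim
    have hτT : τ ∈ ST := by
      refine ⟨hτre, lt_of_le_of_lt hτim ?_⟩
      rw [div_lt_iff₀ hK, inv_mul_cancel₀ hK.ne']; exact hθ1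
    rw [hB_T τ hτT]
    simp only [hJf]
    set Sθ : ℝ := ∑' k : ℕ, (6 * (k : ℝ) ^ 2 + 2) * θ ^ k with hSθ
    have hSθ0 : 0 ≤ Sθ := tsum_nonneg fun k => by positivity
    have hJb := norm_strip_le hρ hc hC hK hGdH hGremH ha hθ0 hθ1 hτre hτim
    have hn : ‖(1 / (2 * π) : ℂ)‖ = 1 / (2 * π) := by
      rw [show (1 / (2 * π) : ℂ) = ((1 / (2 * π) : ℝ) : ℂ) by push_cast; ring, Complex.norm_real,
        Real.norm_of_nonneg (by positivity)]
    -- `L(t) ≤ e^{ct}·(1 + K∕c + K²∕(2c²))` and `1 ≤ e^{ct}`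
    set t : ℝ := τ.re with htdef
    have het : 1 ≤ Real.exp (c * t) := Real.one_le_exp (by positivity)
    have hct : c * t ≤ Real.exp (c * t) := by linarith [Real.add_one_le_exp (c * t)]
    have hL : 1 + K * t + Real.exp (c * t) * K ^ 2 / (2 * c ^ 2) ≤ Real.exp (c * t) * (1 + K / c + K ^ 2 / (2 * c ^ 2)) := by
      have h1 : K * t ≤ Real.exp (c * t) * (K / c) := by
        calc K * t = K / c * (c * t) := by field_simp
          _ ≤ K / c * Real.exp (c * t) := mul_le_mul_of_nonneg_left hct (by positivity)
          _ = Real.exp (c * t) * (K / c) := mul_comm _ _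
      have e : Real.exp (c * t) * (1 + K / c + K ^ 2 / (2 * c ^ 2)) =
          Real.exp (c * t) + Real.exp (c * t) * (K / c) + Real.exp (c * t) * K ^ 2 / (2 * c ^ 2) := by ring
      rw [e]; linarith
    calc ‖a 0 + (1 / (2 * π) : ℂ) * 𝒥 τ‖ ≤ ‖a 0‖ + ‖(1 / (2 * π) : ℂ)‖ * ‖𝒥 τ‖ := by
          refine (norm_add_le _ _).trans ?_; rw [norm_mul]
      _ ≤ ‖a 0‖ * Real.exp (c * t) + 1 / (2 * π) *
          (2 * π * C * (1 + K * t + Real.exp (c * t) * K ^ 2 / (2 * c ^ 2)) * Sθ) := by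
          rw [hn]
          exact add_le_add (le_mul_of_one_le_right (norm_nonneg _) het) (mul_le_mul_of_nonneg_left hJb (by positivity))
      _ = ‖a 0‖ * Real.exp (c * t) + C * Sθ * (1 + K * t + Real.exp (c * t) * K ^ 2 / (2 * c ^ 2)) := by
          field_simp
      _ ≤ ‖a 0‖ * Real.exp (c * t) + C * Sθ * (Real.exp (c * t) * (1 + K / c + K ^ 2 / (2 * c ^ 2))) := by
          gcongr
      _ = (‖a 0‖ + C * (1 + K / c + K ^ 2 / (2 * c ^ 2)) * Sθ) * Real.exp (c * t) := by ring
  -- (4) the Laplace integral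
  · intro z hz
    set w : ℂ := z⁻¹ with hw
    have hwre : ρ < w.re := hz
    have hwpos : 0 < w.re := hρ.trans hwre
    have hw0 : w ≠ 0 := fun h => by rw [h, Complex.zero_re] at hwpos; exact lt_irrefl _ hwpos
    have hzw : z = w⁻¹ := by rw [hw, inv_inv]
    have hlap : G w = ∫ t in Ioi (0 : ℝ), cexp (-(t : ℂ) * w) * b t := by
      rw [laplace_repr hρ hM₀ hGdH hGbH w hwre]
      refine setIntegral_congr_fun measurableSet_Ioi fun t _ => ?_
      rw [hbindep w.re hwre t]
    set c' : ℝ := (ρ + w.re) / 2 with hc'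
    have hc'gt : ρ < c' := by rw [hc']; linarith
    have hc'lt : c' < w.re := by rw [hc']; linarith
    have hc'pos : 0 < c' := hρ.trans hc'gt
    have hbc : Continuous b := continuous_bline hρ hM₀ hGdH hGbH hc
    have hint_b : IntegrableOn (fun t : ℝ => cexp (-(t : ℂ) * w) * b t) (Ioi 0) := by
      have hcont : ContinuousOn (fun t : ℝ => cexp (-(t : ℂ) * w) * b t) (Ioi 0) :=
        ((by fun_prop : Continuous fun t : ℝ => cexp (-(t : ℂ) * w)).mul hbc).continuousOn
      refine Integrable.mono' ((exp_neg_integrableOn_Ioi 0 (by linarith : 0 < w.re - c')).const_mul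
        (C * K / (2 * c'))) (hcont.aestronglyMeasurable measurableSet_Ioi) ?_
      refine (ae_restrict_iff' measurableSet_Ioi).mpr (Eventually.of_forall fun t _ => ?_)
      rw [norm_mul, Complex.norm_exp]
      have hre : (-(t : ℂ) * w).re = -(t * w.re) := by simp
      rw [hre, ← hbindep c' hc'gt t]
      calc Real.exp (-(t * w.re)) * ‖(1 / (2 * π) : ℂ) * (Real.exp (c' * t) : ℂ) *
            𝓕 (fun x : ℝ => G ((c' : ℂ) - (x : ℂ) * I)) (t / (2 * π))‖
          ≤ Real.exp (-(t * w.re)) * (C * K / (2 * c') * Real.exp (c' * t)) :=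
            mul_le_mul_of_nonneg_left (norm_bline_le hρ hGbH hc'gt t) (Real.exp_pos _).le
        _ = C * K / (2 * c') * Real.exp (-(w.re - c') * t) := by
            rw [mul_comm, mul_assoc, ← Real.exp_add]; congr 2; ring
    obtain ⟨hint_a, hexpint⟩ := laplace_const hwpos (a 0)
    have hB_Ioi : ∀ t ∈ Ioi (0 : ℝ), cexp (-(t : ℂ) * w) * B t = cexp (-(t : ℂ) * w) * a 0 + cexp (-(t : ℂ) * w) * b t := by
      intro t ht
      rw [hB_real t ht, mul_add]
    have hint_B : IntegrableOn (fun t : ℝ => cexp (-(t : ℂ) * w) * B t) (Ioi 0) :=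
      (hint_a.add hint_b).congr_fun (fun t ht => (hB_Ioi t ht).symm) measurableSet_Ioi
    refine ⟨hint_B, ?_⟩
    have hLB : ∫ t in Ioi (0 : ℝ), cexp (-(t : ℂ) * w) * B t = a 0 / w + G w := by
      rw [setIntegral_congr_fun measurableSet_Ioi hB_Ioi, integral_add hint_a hint_b, hexpint, hlap]
    have hfG : f w⁻¹ = a 0 + w * G w := by
      simp only [hG]; field_simp; ring
    rw [hLB, hzw, hfG]
    field_simp

end

end Summit.QuantumFields.BalabanUV.Beta.EriceFlowEnclosureBorelNevanlinna
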